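import Summits.AtomisticToContinuum.HydrodynamicLimit.Theorems.InformationPercolationEnginePercolationClosesChaosForecastDefs
import Summits.AtomisticToContinuum.HydrodynamicLimit.Theorems.InformationPercolationEngineKickFairRelEquilibriumMesoPastMeasurable
import HarnessLib

/-!
# Forecast transfer S6 of the line `equilibrium-forecast-chain-rule` (crux `InformationPercolationEngine.PercolationClosesChaos`,
stmt-AtomisticToContinuum-15178) — piece O: the atoms of one sphere's observation are Borel

Support file (`--supports stmt-AtomisticToContinuum-15178`) of the registered stub
`stub_forecastTransfer : PredictableProjection → MesoConditionalEquidistribution → LocalCountUI → NoMesoscopicOscillation →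
CoarseLocalMaxwellianity → RevealedDefectStability → KineticCellChaosLG` (worker S6 of lead c3), equally needed by S5.
The mesoscopic filtration of the line (`hist`, `seqHist`, `seqHistEnd`, `seqHistLE` of `…ForecastDefs`) is generated by the
observations `obs b c σ N Φ k z i : Obs N` (cell and velocity bin of sphere `i` at time `kΔ`, and its reduced collision records
`jumps` of the step just ended) — values in a COUNTABLE alphabet without a `MeasurableSpace` instance (lists). The engine
`PredictableProjection` conditions on `MeasurableSpace.comap (…) ⊤`, which is a genuine sub-σ-algebra of the Borel one exactly
when every ATOM `{z | obs … k z i = y}` is Borel. This file proves that (`measurableSet_obs_eq`, the registered headline), by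

* `measurableSet_inter_fiber_of_factors` — a map that, on a measurable piece, factors setwise through a countably-valued map
  with measurable fibres has measurable fibres on that piece (countable union of fibres);
* `measurable_velBin`, `measurable_decide`, `measurable_jumpEntry_good` — the binned record entries
  (partner, binned `v_i⁻, v_i⁺, v_j⁻`) of the `n`-th collision of `i` are measurable on the good set (PastMeasurable file:
  `measurable_nthPartnerOf_good`, `measurable_nthRecordOf_good`, `measurable_nthCollisionTimeOf_good`);
* `measurableSet_jumps_eq_good` — on the piece `{count = c₀}` of the good set the list `jumps` is a function of the finite vector
  of the first `c₀` (window test, entry) pairs, a countable type; the count is measurable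
  (`measurable_ite_ncard_collisionTimesOf_inter_Ioc`);
* `measurableSet_obs_eq_good`, `measurableSet_obs_eq` — cut to the good set as in crux 2 (`obs` is constant off `Φ.good`).

Bookkeeping only; no dynamics beyond the PastMeasurable port.
-/

noncomputable section

open MeasureTheory Set Filter Topology
open scoped ENNReal BigOperators Classical
open Literature.Analysis.FluidPDE Literature.MathematicalPhysics.KineticTheory
open Literature.MathematicalPhysics.KineticTheory.VelocityBlindPlacement

namespace Summit.AtomisticToContinuum.HydrodynamicLimit.Theorems.EquilibriumForecastLine

/-! ## Fibres of maps factoring through a countably-valued map -/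

/-- **Fibres by factorisation.** If, on a measurable piece `E`, the map `f` is a (setwise) function of a map `g` into a COUNTABLE
type all of whose fibres are measurable, then every fibre of `f` meets `E` in a measurable set (it is `E ∩` a countable union of
fibres of `g`). [folklore] -/
theorem measurableSet_inter_fiber_of_factors {Ω A B : Type*} [MeasurableSpace Ω] [Countable B] {E : Set Ω}
    (hE : MeasurableSet E) {g : Ω → B} (hg : ∀ b, MeasurableSet (g ⁻¹' {b})) {f : Ω → A}
    (hf : ∀ z ∈ E, ∀ z' ∈ E, g z = g z' → f z = f z') (a : A) : MeasurableSet (E ∩ {z | f z = a}) := by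
  have hset : E ∩ {z | f z = a} = E ∩ ⋃ b ∈ g '' (E ∩ {z | f z = a}), g ⁻¹' {b} := by
    ext z
    simp only [mem_inter_iff, mem_setOf_eq, mem_iUnion, mem_image, mem_preimage, mem_singleton_iff, exists_prop]
    constructor
    · rintro ⟨hz, hfz⟩
      exact ⟨hz, g z, ⟨z, ⟨hz, hfz⟩, rfl⟩, rfl⟩
    · rintro ⟨hz, b, ⟨z', ⟨hz', hfz'⟩, rfl⟩, hzb⟩
      exact ⟨hz, (hf z hz z' hz' hzb).trans hfz'⟩
  rw [hset]
  exact hE.inter (MeasurableSet.biUnion (Set.to_countable _) fun b _ => hg b)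

/-- Fibres by factorisation, whole space: a setwise function of a countably-valued map with measurable fibres has measurable
fibres. [folklore] -/
theorem measurableSet_fiber_of_factors {Ω A B : Type*} [MeasurableSpace Ω] [Countable B] {g : Ω → B}
    (hg : ∀ b, MeasurableSet (g ⁻¹' {b})) {f : Ω → A} (hf : ∀ z z', g z = g z' → f z = f z') (a : A) :
    MeasurableSet {z | f z = a} := by
  have h := measurableSet_inter_fiber_of_factors MeasurableSet.univ hg (fun z _ z' _ h => hf z z' h) a
  rwa [univ_inter] at h

/-- A measurable map into a space with measurable singletons has measurable fibres (restatement for the shape `{z | g z = b}`).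
[folklore] -/
theorem measurableSet_fiber {Ω B : Type*} [MeasurableSpace Ω] [MeasurableSpace B] [MeasurableSingletonClass B] {g : Ω → B}
    (hg : Measurable g) (b : B) : MeasurableSet {z | g z = b} :=
  hg (measurableSet_singleton b)

/-! ## Binned record entries on the good set -/

/-- The velocity bin map `v ↦ (⌊v_m / b⌋)_m` is measurable. [folklore] -/
theorem measurable_velBin (b : ℝ) : Measurable (velBin b) :=
  measurable_pi_lambda _ fun m =>
    Int.measurable_floor.comp (((PiLp.continuous_apply 2 (fun _ : Fin 3 => ℝ) m).measurable).div_const b)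

/-- A decided measurable predicate is a measurable `Bool`-valued map. [folklore] -/
theorem measurable_decide {Ω : Type*} [MeasurableSpace Ω] {p : Ω → Prop} [DecidablePred p] (hp : MeasurableSet {z | p z}) :
    Measurable fun z => decide (p z) := by
  refine measurable_to_countable' fun x => ?_
  cases x
  · have : (fun z => decide (p z)) ⁻¹' {false} = {z | p z}ᶜ := by
      ext z; simp
    rw [this]
    exact hp.compl
  · have : (fun z => decide (p z)) ⁻¹' {true} = {z | p z} := by
      ext z; simp
    rw [this]
    exact hp

section Good

variable {σ : ℝ} {N : ℕ} (Φ : Flow σ N)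

/-- The binned entry (partner, `v_i⁻`, `v_i⁺`, `v_j⁻` bins) of the `n`-th collision of `i` is measurable on the good set.
[folklore] -/
theorem measurable_jumpEntry_good (b : ℝ) (i : Fin (N + 1)) (n : ℕ) :
    Measurable fun z : Φ.good =>
      ((Φ.nthPartnerOf i n (z : Phase N), velBin b (Φ.nthRecordOf i n (z : Phase N)).preVel.1,
        velBin b (Φ.nthRecordOf i n (z : Phase N)).postVel.1, velBin b (Φ.nthRecordOf i n (z : Phase N)).preVel.2) :
        Fin (N + 1) × Cell × Cell × Cell) := by
  have hr := KickFairRelEquilibriumMesoLine.measurable_nthRecordOf_good Φ i n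
  refine (KickFairRelEquilibriumMesoLine.measurable_nthPartnerOf_good Φ i n).prodMk (((measurable_velBin b).comp
    (HardSphereCollisionRecord.measurable_preVel.comp hr).fst).prodMk (((measurable_velBin b).comp
    (HardSphereCollisionRecord.measurable_postVel.comp hr).fst).prodMk ((measurable_velBin b).comp
    (HardSphereCollisionRecord.measurable_preVel.comp hr).snd)))

/-- The window test `(k − 1)Δ < t_n(i)` of the `n`-th collision time is a measurable `Bool` on the good set. [folklore] -/
theorem measurable_windowTest_good (c : ℝ) (k : ℕ) (i : Fin (N + 1)) (n : ℕ) :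
    Measurable fun z : Φ.good =>
      decide (((k : ℝ) - 1) * stepLen c σ N < Φ.nthCollisionTimeOf i n (z : Phase N)) :=
  measurable_decide (measurableSet_lt measurable_const (KickFairRelEquilibriumMesoLine.measurable_nthCollisionTimeOf_good Φ i n))

/-- The count of collision times of `i` in `(0, w]` is measurable on the good set. [folklore] -/
theorem measurable_ncard_good (i : Fin (N + 1)) (w : ℝ) :
    Measurable fun z : Φ.good =>
      (collisionTimesOf G3 (hsDiameter σ N) (fun t => Φ.flow t (z : Phase N)) i ∩ Set.Ioc 0 w).ncard := by
  have h : Measurable fun z : Φ.good => if (z : Phase N) ∈ Φ.good then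
      (collisionTimesOf G3 (hsDiameter σ N) (fun t => Φ.flow t (z : Phase N)) i ∩ Set.Ioc 0 w).ncard else 0 :=
    (KickFairRelEquilibriumMesoLine.measurable_ite_ncard_collisionTimesOf_inter_Ioc Φ i w).comp measurable_subtype_coe
  have heq : (fun z : Φ.good =>
      (collisionTimesOf G3 (hsDiameter σ N) (fun t => Φ.flow t (z : Phase N)) i ∩ Set.Ioc 0 w).ncard) =
      fun z : Φ.good => if (z : Phase N) ∈ Φ.good then
        (collisionTimesOf G3 (hsDiameter σ N) (fun t => Φ.flow t (z : Phase N)) i ∩ Set.Ioc 0 w).ncard else 0 :=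
    funext fun z => (if_pos z.2).symm
  rw [heq]
  exact h

/-- `jumps` is determined by the count of collision times in `(0, kΔ]` and the (window test, binned entry) pairs of the
collisions below the count. [folklore] -/
theorem jumps_congr (b c : ℝ) (k : ℕ) (i : Fin (N + 1)) {z z' : Phase N}
    (hcnt : (collisionTimesOf G3 (hsDiameter σ N) (fun t => Φ.flow t z) i ∩ Set.Ioc 0 ((k : ℝ) * stepLen c σ N)).ncard =
      (collisionTimesOf G3 (hsDiameter σ N) (fun t => Φ.flow t z') i ∩ Set.Ioc 0 ((k : ℝ) * stepLen c σ N)).ncard)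
    (htest : ∀ m < (collisionTimesOf G3 (hsDiameter σ N) (fun t => Φ.flow t z) i ∩
        Set.Ioc 0 ((k : ℝ) * stepLen c σ N)).ncard,
      decide (((k : ℝ) - 1) * stepLen c σ N < Φ.nthCollisionTimeOf i m z) =
        decide (((k : ℝ) - 1) * stepLen c σ N < Φ.nthCollisionTimeOf i m z'))
    (hentry : ∀ m < (collisionTimesOf G3 (hsDiameter σ N) (fun t => Φ.flow t z) i ∩
        Set.Ioc 0 ((k : ℝ) * stepLen c σ N)).ncard,
      ((Φ.nthPartnerOf i m z, velBin b (Φ.nthRecordOf i m z).preVel.1, velBin b (Φ.nthRecordOf i m z).postVel.1,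
          velBin b (Φ.nthRecordOf i m z).preVel.2) : Fin (N + 1) × Cell × Cell × Cell) =
        (Φ.nthPartnerOf i m z', velBin b (Φ.nthRecordOf i m z').preVel.1, velBin b (Φ.nthRecordOf i m z').postVel.1,
          velBin b (Φ.nthRecordOf i m z').preVel.2)) :
    jumps b c σ N Φ k i z = jumps b c σ N Φ k i z' := by
  simp only [jumps]
  rw [← hcnt, List.filter_congr fun m hm => htest m (List.mem_range.1 hm)]
  exact List.map_congr_left fun m hm => hentry m (List.mem_range.1 (List.mem_of_mem_filter hm))

/-- **The atoms of `jumps` are Borel on the good set**: on the piece `{count = c₀}` the list is a function of the vector of the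
first `c₀` (window test, binned entry) pairs. [folklore] -/
theorem measurableSet_jumps_eq_good (b c : ℝ) (k : ℕ) (i : Fin (N + 1)) (l : List (Fin (N + 1) × Cell × Cell × Cell)) :
    MeasurableSet {z : Φ.good | jumps b c σ N Φ k i (z : Phase N) = l} := by
  -- the count and the vector of the first `c₀` (window test, entry) pairs
  set cnt : Φ.good → ℕ := fun z =>
    (collisionTimesOf G3 (hsDiameter σ N) (fun t => Φ.flow t (z : Phase N)) i ∩
      Set.Ioc 0 ((k : ℝ) * stepLen c σ N)).ncard with hcnt
  have hcntm : Measurable cnt := measurable_ncard_good Φ i _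
  set vec : (c₀ : ℕ) → Φ.good → (Fin c₀ → Bool × (Fin (N + 1) × Cell × Cell × Cell)) := fun c₀ z m =>
    (decide (((k : ℝ) - 1) * stepLen c σ N < Φ.nthCollisionTimeOf i m (z : Phase N)),
      (Φ.nthPartnerOf i m (z : Phase N), velBin b (Φ.nthRecordOf i m (z : Phase N)).preVel.1,
        velBin b (Φ.nthRecordOf i m (z : Phase N)).postVel.1, velBin b (Φ.nthRecordOf i m (z : Phase N)).preVel.2))
    with hvec
  have hvecm : ∀ c₀, Measurable (vec c₀) := fun c₀ =>
    measurable_pi_lambda _ fun m =>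
      (measurable_windowTest_good Φ c k i m).prodMk (measurable_jumpEntry_good Φ b i m)
  -- on `{cnt = c₀}` the list is a function of `vec c₀`
  have hfac : ∀ c₀, ∀ z ∈ {z | cnt z = c₀}, ∀ z' ∈ {z | cnt z = c₀}, vec c₀ z = vec c₀ z' →
      jumps b c σ N Φ k i (z : Phase N) = jumps b c σ N Φ k i (z' : Phase N) := by
    intro c₀ z hz z' hz' hzz
    have hz : cnt z = c₀ := hz
    have hz' : cnt z' = c₀ := hz'
    have hcomp : ∀ m (hm : m < c₀), vec c₀ z ⟨m, hm⟩ = vec c₀ z' ⟨m, hm⟩ := fun m hm => by rw [hzz]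
    simp only [hvec, Prod.mk.injEq] at hcomp
    refine jumps_congr Φ b c k i (hz.trans hz'.symm) (fun m hm => (hcomp m (lt_of_lt_of_eq hm hz)).1)
      fun m hm => ?_
    obtain ⟨-, h1, h2, h3, h4⟩ := hcomp m (lt_of_lt_of_eq hm hz)
    rw [h1, h2, h3, h4]
  have hunion : {z : Φ.good | jumps b c σ N Φ k i (z : Phase N) = l} =
      ⋃ c₀ : ℕ, ({z | cnt z = c₀} ∩ {z | jumps b c σ N Φ k i (z : Phase N) = l}) := by
    ext z
    simp only [mem_setOf_eq, mem_iUnion, mem_inter_iff, exists_eq_left']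
  rw [hunion]
  refine MeasurableSet.iUnion fun c₀ => ?_
  exact measurableSet_inter_fiber_of_factors (measurableSet_fiber hcntm c₀)
    (fun v => measurableSet_fiber (hvecm c₀) v) (hfac c₀) l

/-- **The atoms of one sphere's observation are Borel on the good set.** [folklore] -/
theorem measurableSet_obs_eq_good (b c : ℝ) (k : ℕ) (i : Fin (N + 1)) (y : Obs N) :
    MeasurableSet {z : Φ.good | obs b c σ N Φ k (z : Phase N) i = y} := by
  have hflow : Measurable fun z : Φ.good => (Φ.flow ((k : ℝ) * stepLen c σ N) (z : Phase N)) i :=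
    (measurable_pi_apply i).comp ((Φ.measurable_flow _).comp measurable_subtype_coe)
  have hcell : Measurable fun z : Φ.good => cellOf c σ N ((Φ.flow ((k : ℝ) * stepLen c σ N) (z : Phase N)) i).1 :=
    (Torus.measurable_coarseCell _).comp hflow.fst
  have hbin : Measurable fun z : Φ.good => velBin b ((Φ.flow ((k : ℝ) * stepLen c σ N) (z : Phase N)) i).2 :=
    (measurable_velBin b).comp hflow.snd
  have hset : {z : Φ.good | obs b c σ N Φ k (z : Phase N) i = y} =
      {z : Φ.good | cellOf c σ N ((Φ.flow ((k : ℝ) * stepLen c σ N) (z : Phase N)) i).1 = y.1.1} ∩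
        {z : Φ.good | velBin b ((Φ.flow ((k : ℝ) * stepLen c σ N) (z : Phase N)) i).2 = y.1.2} ∩
        {z : Φ.good | jumps b c σ N Φ k i (z : Phase N) = y.2} := by
    ext z
    simp only [mem_setOf_eq, mem_inter_iff, obs, if_pos z.2, Prod.ext_iff]
  rw [hset]
  exact ((measurableSet_fiber hcell _).inter (measurableSet_fiber hbin _)).inter
    (measurableSet_jumps_eq_good Φ b c k i y.2)

end Good

/-- **Registered helper `measurableSet_obs_eq` (piece O of S5/S6): the atoms of one sphere's observation at a step boundary are
Borel** — for every flow of the crux, bin width `b`, scale `c`, step `k`, sphere `i` and value `y`, the set of initial data whose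
observation `obs b c σ N Φ k · i` equals `y` is measurable (cut to the good set, on which cells, bins and the reduced collision
records are measurable functions of the datum; constant off it). [folklore] -/
theorem measurableSet_obs_eq : ∀ {σ : ℝ} {N : ℕ} (Φ : Flow σ N) (b c : ℝ) (k : ℕ) (i : Fin (N + 1)) (y : Obs N), MeasurableSet {z : Phase N | obs b c σ N Φ k z i = y} := by
  intro σ N Φ b c k i y
  have hset : {z : Phase N | obs b c σ N Φ k z i = y} =
      Subtype.val '' {z : Φ.good | obs b c σ N Φ k (z : Phase N) i = y} ∪
        (Φ.goodᶜ ∩ {_z | (((0, 0), []) : Obs N) = y}) := by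
    ext z
    simp only [mem_setOf_eq, mem_union, mem_image, mem_inter_iff, mem_compl_iff, Subtype.exists, exists_and_right,
      exists_eq_right]
    by_cases hz : z ∈ Φ.good
    · constructor
      · intro h; exact Or.inl ⟨hz, h⟩
      · rintro (⟨_, h⟩ | ⟨h, _⟩)
        · exact h
        · exact absurd hz h
    · have hoff : obs b c σ N Φ k z i = ((0, 0), []) := by
        simp only [obs, if_neg hz]
      rw [hoff]
      constructor
      · intro h; exact Or.inr ⟨hz, h⟩
      · rintro (⟨h, _⟩ | ⟨_, h⟩)
        · exact absurd h hz
        · exact h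
  rw [hset]
  refine (MeasurableSet.subtype_image Φ.measurableSet_good (measurableSet_obs_eq_good Φ b c k i y)).union
    (Φ.measurableSet_good.compl.inter ?_)
  by_cases hy : (((0, 0), []) : Obs N) = y
  · simp only [hy, setOf_true, MeasurableSet.univ]
  · simp only [hy, setOf_false, MeasurableSet.empty]

end Summit.AtomisticToContinuum.HydrodynamicLimit.Theorems.EquilibriumForecastLine

end
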